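import Summits.AtomisticToContinuum.Crystallization.Theorems.ChartedZeroExcessLayeredLatticeLiouvilleZZZYL

/-!
# ChartedZeroExcess · LayeredLatticeLiouville ZZZYM (lens-2 g95 NODE 95b «TensionCredit») — part A of two — THE SHARP BONDWISE LEDGER: FAR-SHELL TENSION CREDITS KEPT,
# THE JENSEN-POINT STRETCH MODULUS PROVED, THE GENERIC LEDGER GLUE, PIECE (QL♯ᴸ)(c) AND DOOR W2m.
(Split for the 400-line cap: THIS PART A = §1 the tension credit + §2 the Jensen-point modulus; part B `…ZZZYM` = §3 the generic floor, the glue,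
piece (QL♯ᴸ)(c) and door W2m.  This docstring describes the whole node; same namespace in both parts.)
Docket `stmt-AtomisticToContinuum-26636` (crux `ChartedZeroExcessLayered`), W2 line; beneath NODE 95 (file ZZZYL: (BCᴸ′)(c) ⟸ (QLᴸ′)(c), door W2l).
WHY (desk findings «LONGWAVE-95» / «TENSION-CREDIT-95», memo NODE-g95.md §1 (D)(E)): the certificate currency of the W2 line is the `pairDevSq` metric over
ALL label pairs up to `Rg = 121/25`, and the honest bulk floor of a `v`-independent windowed Bloch table is its LONG-WAVE limit (the infimum over `k → 0`,
which the finite `nk³` grids of the morning approached from above).  In that limit the typed ledger of ZZZYL — which DROPS every tension credit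
`V'(‖b‖) · bondExcess b v ≥ 0` of the far shells (`‖b‖ ≥ √2 · 0.9 > 2^{1/6}`) — keeps only 59–81 % of the exact second-order floor, and its windowed
certificate at the registered `(τ⋆, sb⁺) = (249/10000, 1/50)` is positive on the whole conformal-admissible label family only for `sb₁ ≲ 1/1000`, with
single-digit margins.  KEEPING the tension credits through the explicit transverse lower bound `bondExcess b v ≥ (‖v‖² − (⟪b,v⟫/‖b‖)²)/(2‖b‖ + 2‖v‖)`
(PROVED here) restores 89–100 % of the exact floor and a certificate positive on the whole family for `sb₁ ≤ 1/300` (margins ≥ +10 %; ≥ +18 % at `1/400`).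
THIS FILE (all PROVED, 0 sorry):
* `perpSq b v = ‖v‖² − (⟪b,v⟫/‖b‖)²` (`≥ 0`, Cauchy–Schwarz) and **`perpSq_div_le_bondExcess`**: `perpSq b v / (2‖b‖ + 2‖v‖) ≤ bondExcess b v` (`b ≠ 0`, every `v`);
* **`pairLedgerSharp b v = pairLedgerLower b v + max (V'(‖b‖)) 0 · perpSq b v / (2‖b‖ + 2‖v‖)`** — the g95 ledger plus the TENSION CREDIT; bondwise domination
  `pairLedgerSharp b v ≤ V(‖b + v‖) − V(‖b‖) − V'(‖b‖)‖b‖⁻¹⟪b, v⟫` (every `b ≠ 0`, every `v`) and `pairLedgerLower ≤ pairLedgerSharp`;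
* **THE JENSEN-POINT STRETCH MODULUS** `bondBregman V V' l l' ≥ ½ V''(l + (l' − l)/3) (l' − l)²` for `0 < l, l' ≤ L`, `L⁶ ≤ 65/12` (where `V⁽⁴⁾ ≥ 0`, i.e.
  `V''` is convex: the tangent line of `V''` at the `1/3`-point integrates against the Taylor kernel `(1 − t)` to exactly `½ V''(l + d/3) d²`) — with
  `ljFourthDeriv`, `hasDerivAt_ljThirdDeriv`, `ljFourthDeriv_nonneg`, the tangent inequality `ljSecondDeriv_tangent_le`; record form below `13/10`;
* the GENERIC piece `SoftLedgerFloorWithP pl …` (the (QLᴸ) text over an arbitrary bond ledger `pl : E3 → E3 → ℝ`; `SoftLedgerFloorP = SoftLedgerFloorWithP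
  pairLedgerLower` by `Iff.rfl`), the GENERIC GLUE `softBregmanCoerciveP_of_dominatedLedger` ((LDᴸ) + bondwise domination of `pl` + the `pl`-floor ⟹ (BCᴸ)(c)),
  the piece **(QL♯ᴸ)(c) `SoftLedgerSharpP … c` := `SoftLedgerFloorWithP pairLedgerSharp … c`**, its one-piece glue `softBregmanCoerciveP_of_sharpLedger :
  (QL♯ᴸ)(c) → (BCᴸ)(c)` and the door `mildCoherentMoatCorePG_W2m` (= W2l with (QLᴸ′) replaced by (QL♯ᴸ′)).
W2 RESIDUAL AFTER THIS FILE (sharp-ledger branch): (X1ᴸ′) ∧ (X2ᴸ′) ∧ (KAᴸ′) ∧ (QL♯ᴸ′)(c > 0) ∧ (OGʰ′⋆)(g₀ > 0), door W2m; (QLᴸ′) (W2l) and the Hessian branch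
(W2i) stay typed as siblings ((QLᴸ′) is the stronger statement bond by bond: `pairLedgerLower ≤ pairLedgerSharp`).
0 sorry · imports: part A = tree ZZZYL only, part B = part A only · whole node: 5 defs (`perpSq`, `pairLedgerSharp`, `ljFourthDeriv`, the `Prop` statements `SoftLedgerFloorWithP`, `SoftLedgerSharpP`),
18 theorems (+ 1 example) · no instances, no notation, no options · axioms standard. [g95]
-/

noncomputable section
open scoped BigOperators Classical InnerProductSpace RealInnerProductSpace
open MeasureTheory Set Metric Filter Topology
open Literature.MathematicalPhysics.StatisticalMechanics (lennardJones interactionEnergy)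

namespace Summit.AtomisticToContinuum.Crystallization.Theorems.ChartedZeroExcessLayeredLatticeLiouville

open Summit.AtomisticToContinuum.Crystallization.Theorems.ChartedPlanarOrderRigidityDoor (E3 IsClean)
open Summit.AtomisticToContinuum.Crystallization.Theorems.ChartedPlanarOrderDensityDichotomy (μS IsSep)
open Summit.AtomisticToContinuum.Crystallization.Theorems.ChartedPlanarOrderCleanScaleP (IsCleanP IsDoorSetP)
open Summit.AtomisticToContinuum.Crystallization.Theorems.ChartedPlanarOrderMesoCut (LayeredHom EnvClose)
open Summit.AtomisticToContinuum.Crystallization.Theorems.ChartedPlanarOrderDoorLayeredOsc (IsTwoShellAffineGood)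
open Summit.AtomisticToContinuum.Crystallization.Theorems.ChartedPlanarOrderNashForceBalance (ljDeriv pairDeriv hasDerivAt_lennardJones)

/-! ### ZZZYM-1  The tension credit (real algebra, PROVED) -/

section TensionCredit

/-- ★ **`perpSq b v = ‖v‖² − (⟪b, v⟫/‖b‖)²` — the squared TRANSVERSE part of the relative displacement `v` of the bond `b`** (for `b ≠ 0`; the exact second-order
tension term of the pair energy is `V'(‖b‖) · perpSq b v / (2‖b‖)`). [this file, g95] -/
def perpSq (b v : E3) : ℝ := ‖v‖ ^ 2 - (⟪b, v⟫ / ‖b‖) ^ 2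

/-- the transverse square is non-negative (Cauchy–Schwarz). [this file, g95] -/
theorem perpSq_nonneg {b : E3} (hb : b ≠ 0) (v : E3) : 0 ≤ perpSq b v := by
  have hnb : 0 < ‖b‖ := norm_pos_iff.2 hb
  have hcs : |⟪b, v⟫| ≤ ‖b‖ * ‖v‖ := abs_real_inner_le_norm b v
  have h1 : |⟪b, v⟫ / ‖b‖| ≤ ‖v‖ := by
    rw [abs_div, abs_of_pos hnb, div_le_iff₀ hnb]
    linarith [mul_comm ‖b‖ ‖v‖]
  have h2 : (⟪b, v⟫ / ‖b‖) ^ 2 ≤ ‖v‖ ^ 2 := sq_le_sq' (abs_le.1 h1).1 (abs_le.1 h1).2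
  unfold perpSq
  linarith

/-- the transverse square is at most `‖v‖²`. [formal bookkeeping] -/
theorem perpSq_le_sq (b v : E3) : perpSq b v ≤ ‖v‖ ^ 2 := by
  unfold perpSq
  linarith [sq_nonneg (⟪b, v⟫ / ‖b‖)]

/-- ★★ **THE TRANSVERSE EXCESS LOWER BOUND (PROVED, no smallness)**: `perpSq b v / (2‖b‖ + 2‖v‖) ≤ bondExcess b v` for `b ≠ 0` — with `a = ‖b‖ + ⟪b,v⟫/‖b‖`
one has `‖b + v‖² = a² + perpSq b v`, so `bondExcess b v = ‖b + v‖ − a = perpSq b v / (‖b + v‖ + a)` and `‖b + v‖ + a ≤ 2‖b‖ + 2‖v‖`.  This is the inequality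
that lets the ledger KEEP the tension credits `V' · bondExcess ≥ V' · perpSq/(2‖b‖ + 2‖v‖)` of the far shells as an explicit quadratic-over-linear form.
[this file, g95] -/
theorem perpSq_div_le_bondExcess {b : E3} (hb : b ≠ 0) (v : E3) : perpSq b v / (2 * ‖b‖ + 2 * ‖v‖) ≤ bondExcess b v := by
  have hnb : 0 < ‖b‖ := norm_pos_iff.2 hb
  have hv : 0 ≤ ‖v‖ := norm_nonneg v
  have hN : 0 ≤ ‖b + v‖ := norm_nonneg (b + v)
  have hD : 0 < 2 * ‖b‖ + 2 * ‖v‖ := by positivity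
  have hsq : ‖b + v‖ ^ 2 = ‖b‖ ^ 2 + 2 * ⟪b, v⟫ + ‖v‖ ^ 2 := norm_add_sq_real b v
  have hb0 : ‖b‖ ≠ 0 := hnb.ne'
  set a : ℝ := ‖b‖ + ⟪b, v⟫ / ‖b‖ with ha
  have hkey : ‖b + v‖ ^ 2 = a ^ 2 + perpSq b v := by
    unfold perpSq
    have e : a ^ 2 = ‖b‖ ^ 2 + 2 * ⟪b, v⟫ + (⟪b, v⟫ / ‖b‖) ^ 2 := by
      rw [ha]
      field_simp
      ring
    rw [e, hsq]; ring
  have hp : 0 ≤ perpSq b v := perpSq_nonneg hb v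
  have hcs : ⟪b, v⟫ ≤ ‖b‖ * ‖v‖ := real_inner_le_norm b v
  have haub : a ≤ ‖b‖ + ‖v‖ := by
    rw [ha, add_le_add_iff_left, div_le_iff₀ hnb]; linarith [mul_comm ‖b‖ ‖v‖]
  have hNub : ‖b + v‖ ≤ ‖b‖ + ‖v‖ := norm_add_le b v
  have hNa : a ≤ ‖b + v‖ := by
    by_contra hlt
    rw [not_le] at hlt
    rcases le_or_gt 0 a with ha0 | ha0
    · nlinarith [mul_self_lt_mul_self hN hlt]
    · linarith
  have hX : bondExcess b v = ‖b + v‖ - a := by unfold bondExcess; rw [ha]; ring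
  rw [hX, div_le_iff₀ hD]
  nlinarith [mul_le_mul_of_nonneg_left (add_le_add hNub haub) (sub_nonneg.2 hNa)]

/-- ★★ **`pairLedgerSharp b v` — THE SHARP BONDWISE LEDGER**: the g95 lower ledger `pairLedgerLower b v` (compression charge + exact stretch Bregman) PLUS the
TENSION CREDIT `max (V'(‖b‖)) 0 · perpSq b v / (2‖b‖ + 2‖v‖)` of a bond in tension.  Still an explicit function of `‖b‖`, `‖b + v‖`, `‖v‖` and `⟪b, v⟫`
(interval-arithmetic friendly); to second order it reproduces the EXACT pair form on tension bonds. [this file, g95] -/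
def pairLedgerSharp (b v : E3) : ℝ :=
  pairLedgerLower b v + max (ljDeriv ‖b‖) 0 * (perpSq b v / (2 * ‖b‖ + 2 * ‖v‖))

/-- the sharp ledger dominates the lower ledger (the credit is non-negative). [this file, g95] -/
theorem pairLedgerLower_le_pairLedgerSharp {b : E3} (hb : b ≠ 0) (v : E3) : pairLedgerLower b v ≤ pairLedgerSharp b v := by
  unfold pairLedgerSharp
  have hD : 0 < 2 * ‖b‖ + 2 * ‖v‖ := by have := norm_pos_iff.2 hb; positivity
  have : 0 ≤ max (ljDeriv ‖b‖) 0 * (perpSq b v / (2 * ‖b‖ + 2 * ‖v‖)) :=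
    mul_nonneg (le_max_right _ _) (div_nonneg (perpSq_nonneg hb v) hD.le)
  linarith

/-- ★ **THE SIGNED TENSION TERM (PROVED)**: compression charge plus tension credit is below `V'(‖b‖) · bondExcess b v` (`b ≠ 0`): for `V' ≥ 0` the credit uses
`perpSq_div_le_bondExcess`, for `V' < 0` the charge uses `bondExcess_le_sq_div_two`. [this file, g95] -/
theorem signedTension_le {b : E3} (hb : b ≠ 0) (v : E3) :
    min (ljDeriv ‖b‖) 0 * (‖v‖ ^ 2 / (2 * ‖b‖)) + max (ljDeriv ‖b‖) 0 * (perpSq b v / (2 * ‖b‖ + 2 * ‖v‖)) ≤ ljDeriv ‖b‖ * bondExcess b v := by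
  have hlo : perpSq b v / (2 * ‖b‖ + 2 * ‖v‖) ≤ bondExcess b v := perpSq_div_le_bondExcess hb v
  have hhi : bondExcess b v ≤ ‖v‖ ^ 2 / (2 * ‖b‖) := bondExcess_le_sq_div_two hb v
  rcases le_or_gt 0 (ljDeriv ‖b‖) with hpos | hneg
  · rw [min_eq_right hpos, max_eq_left hpos, zero_mul, zero_add]
    exact mul_le_mul_of_nonneg_left hlo hpos
  · rw [min_eq_left hneg.le, max_eq_right hneg.le, zero_mul, add_zero]
    exact mul_le_mul_of_nonpos_left hhi hneg.le

/-- ★★ **BONDWISE DOMINATION OF THE SHARP LEDGER (PROVED, every `b ≠ 0`, every `v`)**. [this file, g95] -/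
theorem pairLedgerSharp_le {b : E3} (hb : b ≠ 0) (v : E3) :
    pairLedgerSharp b v ≤ lennardJones ‖b + v‖ - lennardJones ‖b‖ - ljDeriv ‖b‖ * ‖b‖⁻¹ * ⟪b, v⟫ := by
  rw [pair_ledger lennardJones ljDeriv b v]
  unfold pairLedgerSharp pairLedgerLower
  linarith [signedTension_le hb v]

/-- ★★ **THE SAME IN THE TREE'S TERMS (PROVED)**: `pairLedgerSharp (x − q) v ≤ V(‖x + v − q‖) − V(‖x − q‖) − pairDeriv x q v` for `x ≠ q`. [this file, g95] -/
theorem pairLedgerSharp_le_pairTerm {x q : E3} (hx : x ≠ q) (v : E3) :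
    pairLedgerSharp (x - q) v ≤ lennardJones ‖x + v - q‖ - lennardJones ‖x - q‖ - pairDeriv x q v := by
  rw [lennardJones_pair_ledger x q v]
  unfold pairLedgerSharp pairLedgerLower
  linarith [signedTension_le (sub_ne_zero.2 hx) v]

end TensionCredit

/-! ### ZZZYM-2  The Jensen-point stretch modulus (real analysis, PROVED) -/

section Jensen

/-- ★ **`ljFourthDeriv r = 2730 r⁻¹⁶ − 504 r⁻¹⁰`** — the fourth-derivative table of `V_LJ`: NON-NEGATIVE below `(65/12)^{1/6} ≈ 1.3253`, so on the whole
nearest-neighbour window `V''` is CONVEX — the hypothesis of the Jensen-point modulus. [this file, g95] -/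
def ljFourthDeriv (r : ℝ) : ℝ := 2730 * (r⁻¹) ^ 16 - 504 * (r⁻¹) ^ 10

/-- `ljThirdDeriv` is differentiable away from `0` with derivative `ljFourthDeriv`. [this file, g95] -/
theorem hasDerivAt_ljThirdDeriv {r : ℝ} (hr : r ≠ 0) : HasDerivAt ljThirdDeriv (ljFourthDeriv r) r := by
  have hinv : HasDerivAt (fun y : ℝ => y⁻¹) (-(r ^ 2)⁻¹) r := hasDerivAt_inv hr
  have h15 := ((hasDerivAt_pow 15 r⁻¹).comp r hinv).const_mul (-182 : ℝ)
  have h9 := ((hasDerivAt_pow 9 r⁻¹).comp r hinv).const_mul (56 : ℝ)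
  have h := h15.add h9
  refine (h.congr_of_eventuallyEq (Eventually.of_forall fun y => ?_)).congr_deriv ?_
  · simp [ljThirdDeriv, Function.comp]
  · simp only [ljFourthDeriv, ← inv_pow]
    ring

/-- `V_LJ⁽⁴⁾ ≥ 0` for `0 < r`, `r⁶ ≤ 65/12`. [this file, g95] -/
theorem ljFourthDeriv_nonneg {r : ℝ} (hr : 0 < r) (h : r ^ 6 ≤ 65 / 12) : 0 ≤ ljFourthDeriv r := by
  have hi : 0 < r⁻¹ := inv_pos.2 hr
  have h10 : 0 < (r⁻¹) ^ 10 := pow_pos hi 10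
  have h6 : 12 / 65 ≤ (r⁻¹) ^ 6 := by
    rw [inv_pow, le_inv_comm₀ (by norm_num) (pow_pos hr 6)]
    have e : (12 / 65 : ℝ)⁻¹ = 65 / 12 := by norm_num
    rw [e]; exact h
  have e16 : (r⁻¹) ^ 16 = (r⁻¹) ^ 10 * (r⁻¹) ^ 6 := by ring
  unfold ljFourthDeriv
  rw [e16]
  nlinarith [mul_nonneg h10.le (show (0 : ℝ) ≤ 2730 * (r⁻¹) ^ 6 - 504 by linarith)]

/-- ★ **THE TANGENT INEQUALITY FOR `V''` (PROVED)**: for `0 < s, u ≤ L` with `L⁶ ≤ 65/12`, `V''(s) + V⁽³⁾(s)(u − s) ≤ V''(u)` — `V''` lies above its tangent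
lines on the window where it is convex (Taylor along `τ ↦ s + τ(u − s)` with `V⁽⁴⁾ ≥ 0`). [this file, g95] -/
theorem ljSecondDeriv_tangent_le {s u L : ℝ} (hs : 0 < s) (hu : 0 < u) (hsL : s ≤ L) (huL : u ≤ L) (hL : L ^ 6 ≤ 65 / 12) :
    ljSecondDeriv s + ljThirdDeriv s * (u - s) ≤ ljSecondDeriv u := by
  set e := u - s with he
  have hseg : ∀ t ∈ Icc (0 : ℝ) 1, 0 < s + t * e ∧ s + t * e ≤ L := fun t ht => by
    constructor
    · have : 0 < (1 - t) * s + t * u := by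
        rcases eq_or_lt_of_le ht.2 with h1 | hlt
        · rw [h1]; simpa using hu
        · nlinarith [ht.1, mul_nonneg ht.1 hu.le]
      rw [he]; linarith
    · have : (1 - t) * s + t * u ≤ L := by nlinarith [ht.1, ht.2, mul_le_mul_of_nonneg_left huL ht.1, mul_le_mul_of_nonneg_left hsL (sub_nonneg.2 ht.2)]
      rw [he]; linarith
  have hne : ∀ t ∈ Icc (0 : ℝ) 1, s + t * e ≠ 0 := fun t ht => (hseg t ht).1.ne'
  have hγ : ∀ t : ℝ, HasDerivAt (fun τ : ℝ => s + τ * e) e t := fun t => by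
    simpa using ((hasDerivAt_id' t).mul_const e).const_add s
  have hf : ∀ t ∈ Icc (0 : ℝ) 1, HasDerivAt (fun τ => ljSecondDeriv (s + τ * e) - τ * (e * ljThirdDeriv s))
      (e * ljThirdDeriv (s + t * e) - e * ljThirdDeriv s) t := fun t ht => by
    have h1 := (hasDerivAt_ljSecondDeriv (hne t ht)).comp t (hγ t)
    have h2 := (hasDerivAt_id' t).mul_const (e * ljThirdDeriv s)
    refine (h1.sub h2).congr_deriv ?_
    ring
  have hg : ∀ t ∈ Icc (0 : ℝ) 1, HasDerivAt (fun τ => e * ljThirdDeriv (s + τ * e) - e * ljThirdDeriv s) (e * e * ljFourthDeriv (s + t * e)) t :=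
    fun t ht => by
      have h1 := ((hasDerivAt_ljThirdDeriv (hne t ht)).comp t (hγ t)).const_mul e
      refine (h1.sub_const (e * ljThirdDeriv s)).congr_deriv ?_
      ring
  have hg0 : (fun τ => e * ljThirdDeriv (s + τ * e) - e * ljThirdDeriv s) 0 = 0 := by
    show e * ljThirdDeriv (s + 0 * e) - e * ljThirdDeriv s = 0
    rw [zero_mul, add_zero, sub_self]
  have hh : ∀ t ∈ Icc (0 : ℝ) 1, (0 : ℝ) ≤ e * e * ljFourthDeriv (s + t * e) := fun t ht => by
    have h6 : (s + t * e) ^ 6 ≤ 65 / 12 := (pow_le_pow_left₀ (hseg t ht).1.le (hseg t ht).2 6).trans hL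
    have := ljFourthDeriv_nonneg (hseg t ht).1 h6
    nlinarith [sq_nonneg e]
  have key := taylor_lower_of_deriv2 (m := 0) hf hg hg0 hh
  simp only [zero_mul, add_zero, one_mul, zero_div] at key
  have eu : s + e = u := by rw [he]; ring
  rw [eu] at key
  linarith

/-- ★★ **THE JENSEN-POINT STRETCH MODULUS (PROVED)**: for bond lengths `0 < l, l' ≤ L` with `L⁶ ≤ 65/12`,
`½ V''(l + (l' − l)/3) (l' − l)² ≤ bondBregman V V' l l'` — the Bregman remainder `∫₀¹ (1 − t) V''(l + t d) dt · d²` of a CONVEX `V''` is at least its value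
at the barycentre `t = 1/3` of the kernel `(1 − t)`.  Integral-free proof: the cubic `Q(t) = d²(V''(s) t²/2 + V⁽³⁾(s) d (t³ − t²)/6)`, `s = l + d/3`, has
`Q'' = d²·(tangent line of V'' at s)(l + t d) ≤ d² V''(l + t d)` and `Q(1) = ½ V''(s) d²`; one-variable Taylor (tree `taylor_lower_of_deriv2`) on
`V(l + t d) − t d V'(l) − Q(t)`.  Sharper than the longer-end modulus of ZZZYL by the factor `V''(l + d/3)/V''(l + d)` (≈ 1.15 at `d = τ⋆`). [this file, g95] -/
theorem bondBregman_ge_jensen {l l' L : ℝ} (hl : 0 < l) (hl' : 0 < l') (hlL : l ≤ L) (hl'L : l' ≤ L) (hL : L ^ 6 ≤ 65 / 12) :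
    ljSecondDeriv (l + (l' - l) / 3) / 2 * (l' - l) ^ 2 ≤ bondBregman lennardJones ljDeriv l l' := by
  set d := l' - l with hd
  set s := l + d / 3 with hs
  set g₀ := ljSecondDeriv s with hg₀
  set g₁ := ljThirdDeriv s with hg₁
  have hseg : ∀ t ∈ Icc (0 : ℝ) 1, 0 < l + t * d ∧ l + t * d ≤ L := fun t ht => by
    constructor
    · have : 0 < (1 - t) * l + t * l' := by
        rcases eq_or_lt_of_le ht.2 with h1 | hlt
        · rw [h1]; simpa using hl'
        · nlinarith [ht.1, mul_nonneg ht.1 hl'.le]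
      rw [hd]; linarith
    · have : (1 - t) * l + t * l' ≤ L := by
        nlinarith [ht.1, ht.2, mul_le_mul_of_nonneg_left hl'L ht.1, mul_le_mul_of_nonneg_left hlL (sub_nonneg.2 ht.2)]
      rw [hd]; linarith
  have hs_mem : (1 / 3 : ℝ) ∈ Icc (0 : ℝ) 1 := ⟨by norm_num, by norm_num⟩
  have hs_pos : 0 < s := by have := (hseg (1 / 3) hs_mem).1; rw [hs]; linarith
  have hs_L : s ≤ L := by have := (hseg (1 / 3) hs_mem).2; rw [hs]; linarith
  have hne : ∀ t ∈ Icc (0 : ℝ) 1, l + t * d ≠ 0 := fun t ht => (hseg t ht).1.ne'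
  have hγ : ∀ t : ℝ, HasDerivAt (fun τ : ℝ => l + τ * d) d t := fun t => by
    simpa using ((hasDerivAt_id' t).mul_const d).const_add l
  -- the comparison cubic and its derivatives
  have hQ : ∀ t : ℝ, HasDerivAt (fun τ : ℝ => d ^ 2 * (g₀ * (τ * τ) / 2 + g₁ * d * ((τ * τ * τ) / 6 - (τ * τ) / 6)))
      (d ^ 2 * (g₀ * t + g₁ * d * ((t * t) / 2 - t / 3))) t := fun t => by
    have h2 : HasDerivAt (fun τ : ℝ => τ * τ) (1 * t + t * 1) t := (hasDerivAt_id' t).mul (hasDerivAt_id' t)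
    have h3 : HasDerivAt (fun τ : ℝ => τ * τ * τ) ((1 * t + t * 1) * t + t * t * 1) t := h2.mul (hasDerivAt_id' t)
    have hA := (h2.const_mul g₀).div_const 2
    have hB := ((h3.div_const 6).sub (h2.div_const 6)).const_mul (g₁ * d)
    refine ((hA.add hB).const_mul (d ^ 2)).congr_deriv ?_
    ring
  have hQ' : ∀ t : ℝ, HasDerivAt (fun τ : ℝ => d ^ 2 * (g₀ * τ + g₁ * d * ((τ * τ) / 2 - τ / 3)))
      (d ^ 2 * (g₀ + g₁ * d * (t - 1 / 3))) t := fun t => by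
    have h2 : HasDerivAt (fun τ : ℝ => τ * τ) (1 * t + t * 1) t := (hasDerivAt_id' t).mul (hasDerivAt_id' t)
    have hA := (hasDerivAt_id' t).const_mul g₀
    have hB := ((h2.div_const 2).sub ((hasDerivAt_id' t).div_const 3)).const_mul (g₁ * d)
    refine ((hA.add hB).const_mul (d ^ 2)).congr_deriv ?_
    ring
  have hf : ∀ t ∈ Icc (0 : ℝ) 1, HasDerivAt
      (fun τ => lennardJones (l + τ * d) - τ * (d * ljDeriv l) - d ^ 2 * (g₀ * (τ * τ) / 2 + g₁ * d * ((τ * τ * τ) / 6 - (τ * τ) / 6)))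
      (d * ljDeriv (l + t * d) - d * ljDeriv l - d ^ 2 * (g₀ * t + g₁ * d * ((t * t) / 2 - t / 3))) t := fun t ht => by
    have h1 := (hasDerivAt_lennardJones (hne t ht)).comp t (hγ t)
    have h2 := (hasDerivAt_id' t).mul_const (d * ljDeriv l)
    refine ((h1.sub h2).sub (hQ t)).congr_deriv ?_
    ring
  have hg : ∀ t ∈ Icc (0 : ℝ) 1, HasDerivAt
      (fun τ => d * ljDeriv (l + τ * d) - d * ljDeriv l - d ^ 2 * (g₀ * τ + g₁ * d * ((τ * τ) / 2 - τ / 3)))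
      (d * d * ljSecondDeriv (l + t * d) - d ^ 2 * (g₀ + g₁ * d * (t - 1 / 3))) t := fun t ht => by
    have h1 := ((hasDerivAt_ljDeriv (hne t ht)).comp t (hγ t)).const_mul d
    refine ((h1.sub_const (d * ljDeriv l)).sub (hQ' t)).congr_deriv ?_
    ring
  have hg0 : (fun τ => d * ljDeriv (l + τ * d) - d * ljDeriv l - d ^ 2 * (g₀ * τ + g₁ * d * ((τ * τ) / 2 - τ / 3))) 0 = 0 := by
    show d * ljDeriv (l + 0 * d) - d * ljDeriv l - d ^ 2 * (g₀ * 0 + g₁ * d * ((0 * 0) / 2 - 0 / 3)) = 0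
    ring_nf
  have hh : ∀ t ∈ Icc (0 : ℝ) 1, (0 : ℝ) ≤ d * d * ljSecondDeriv (l + t * d) - d ^ 2 * (g₀ + g₁ * d * (t - 1 / 3)) := fun t ht => by
    have htan := ljSecondDeriv_tangent_le hs_pos (hseg t ht).1 hs_L (hseg t ht).2 hL
    have e : l + t * d - s = d * (t - 1 / 3) := by rw [hs]; ring
    rw [e] at htan
    have h2 : 0 ≤ d ^ 2 := sq_nonneg d
    nlinarith [mul_le_mul_of_nonneg_left htan h2]
  have key := taylor_lower_of_deriv2 (m := 0) hf hg hg0 hh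
  simp only [zero_mul, mul_zero, zero_div, add_zero, sub_zero, one_mul] at key
  have e1 : l + d = l' := by rw [hd]; ring
  rw [e1] at key
  unfold bondBregman
  rw [← hd]
  linarith [key]

/-- the record specialisation: below `13/10` (`(13/10)⁶ ≤ 65/12`) the Jensen-point modulus applies — the whole soft nearest-neighbour window. [this file, g95] -/
theorem bondBregman_ge_jensen_record {l l' : ℝ} (hl : 0 < l) (hl' : 0 < l') (hlL : l ≤ 13 / 10) (hl'L : l' ≤ 13 / 10) :
    ljSecondDeriv (l + (l' - l) / 3) / 2 * (l' - l) ^ 2 ≤ bondBregman lennardJones ljDeriv l l' :=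
  bondBregman_ge_jensen hl hl' hlL hl'L (by norm_num)

end Jensen

end Summit.AtomisticToContinuum.Crystallization.Theorems.ChartedZeroExcessLayeredLatticeLiouville
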